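import Literature.NumberTheory.EllipticCurves.IwasawaSelmerControlAwayFromPProofs
import Literature.NumberTheory.EllipticCurves.UnramifiedCoboundaryInputs
import Literature.NumberTheory.EllipticCurves.SpectralValuationUnramified
import Literature.NumberTheory.EllipticCurves.VariableChangePointsMap
import HarnessLib

/-!
# A Kummer point of `E₁(K_v)` with controlled divisibility (input (C2) of the local skeleton)

`Proofs` file (theorems only) in topic `NumberTheory/EllipticCurves`; part of the local input
(brick B) of the elementary proof of Greenberg's Lemma 3.4 at the layer `n = 0` (LNM 1716, p. 89),
supplying hypothesis (C2) of `ResKernel.finite_primary_subgroupResKer_of_reduction`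
(`IwasawaLocalKummerSkeletonProofs`): a `Γ_{K_v}`-fixed point `u₁` of the kernel of reduction
`E₁(K̄_v)` such that `n u₁ = p^m a` with `a ∈ E(K_v)` forces `p^m ∣ c₁ n` for a constant `c₁`.

* §1 **Level calculus on the formal group** (Silverman, *AEC*, IV.3.2(a), VII.2.2): on
  `E₂ = {|z| < |p|}` the local parameter is multiplicative in norm, `|z(nQ)| = |n| |z(Q)|`
  (`val_zCoord_nsmul_eq_of_lt`), from the tree's first-order estimate
  `|z(NQ) - N z(Q)| ≤ |z(Q)|²` (`FormalGroupChart.val_zCoord_nsmul`).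
* §2 **The index of `E₂(K_v)` in `E(K_v)` is bounded**: `h = p · #Ẽ(k_v)` multiplies every
  `K_v`-rational point into `E₂` (reduction `E(K_v) → Ẽ(k_v)` with kernel `E₁(K_v)`, Silverman
  VII.2.1, and `pE₁ ⊆ E₂`).
* §3 **The point** `u₁ ∈ E₁(K̄_v)` with `z(u₁) = p²`, fixed by `Γ_{K_v}`
  (`exists_mem_kernel_zCoord_eq`), and (C2) with `c₁ = h`.

## References

* [SilvermanAEC2009] J. H. Silverman, *AEC*, IV.3.2, VII.2.1, VII.2.2.
* [GreenbergLNM1716] R. Greenberg, LNM 1716 (1999), §3 Lemma 3.4 (p. 89) (the Kummer image of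
  `E(K_v) ⊗ ℚ_p/ℤ_p`).
-/

noncomputable section

open scoped Classical NNReal
open NumberField IsDedekindDomain

universe u

/-! ## §1 Level calculus on the formal group -/

namespace Literature.NumberTheory.EllipticCurves.FormalGroupChart

variable {F : Type u} [Field F] {w : Valuation F ℝ≥0} {V : WeierstrassCurve F}
  [hV : V.IsIntegral w.integer]

/-- **`|z(NQ)| = |N| |z(Q)|` below the level of `N`**: for `Q ∈ E₁` with `|z(Q)| < |N|`
(`N ∈ ℕ`), the first-order estimate `|z(NQ) - N z(Q)| ≤ |z(Q)|² < |N z(Q)|` gives equality of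
norms. Silverman, *AEC*, IV.3.2(a) / VII.2.2. [cite: SilvermanAEC2009, Prop. VII.2.2] -/
theorem val_zCoord_nsmul_eq_of_lt (N : ℕ) {Q : V.toAffine.Point} (hQ : Q ∈ kernel w V)
    (hlt : w Q.zCoord < w (N : F)) :
    w (N • Q).zCoord = w (N : F) * w Q.zCoord := by
  obtain ⟨-, -, hest⟩ := val_zCoord_nsmul (w := w) (V := V) N hQ
  by_cases h0 : Q.zCoord = 0
  · have hQ0 : Q = 0 := (zCoord_eq_zero_iff (w := w) (V := V) hQ).mp h0
    subst hQ0
    rw [smul_zero, WeierstrassCurve.Affine.Point.zCoord_zero, map_zero, mul_zero]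
  · have hpos : 0 < w Q.zCoord := (Valuation.pos_iff w).mpr h0
    have hlt' : w ((N • Q).zCoord - (N : F) * Q.zCoord) < w ((N : F) * Q.zCoord) := by
      refine lt_of_le_of_lt hest ?_
      rw [map_mul, sq]
      exact mul_lt_mul_of_pos_right hlt hpos
    have key := Valuation.map_add_eq_of_lt_left w hlt'
    rw [add_sub_cancel] at key
    rw [key, map_mul]

/-- **`|z(nQ)| = |n| |z(Q)|` on `E₂`.** Let every natural number prime to the prime `p` be a unit
for `w`. For `Q ∈ E₁` with `|z(Q)| < |p|` and `n ≠ 0`, `|z(nQ)| = |n| |z(Q)|`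
(induction on the `p`-adic valuation of `n`: a prime-to-`p` factor has `|n'| = 1 > |z(Q)|`, and
`|z(pQ)| = |p| |z(Q)| < |p|` stays in `E₂`). Silverman, *AEC*, IV.3.2(a), IV.6.4(b) (torsion-free
below level `p/(p-1)`). [cite: SilvermanAEC2009, Prop. VII.2.2 and Thm. IV.6.4] -/
theorem val_zCoord_nsmul_eq {p : ℕ} (hp : p.Prime)
    (hunit : ∀ n : ℕ, ¬ p ∣ n → w (n : F) = 1) :
    ∀ (n : ℕ), n ≠ 0 → ∀ {Q : V.toAffine.Point}, Q ∈ kernel w V → w Q.zCoord < w (p : F) →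
      w (n • Q).zCoord = w (n : F) * w Q.zCoord := by
  intro n
  induction n using Nat.strong_induction_on with
  | _ n ih =>
    intro hn Q hQ hQp
    have h1 : w Q.zCoord < 1 := val_zCoord_lt_one (w := w) (V := V) hQ
    by_cases hpn : p ∣ n
    · obtain ⟨n₁, rfl⟩ := hpn
      have hn₁ : n₁ ≠ 0 := by rintro rfl; exact hn (mul_zero p)
      have hn₁lt : n₁ < p * n₁ := lt_mul_left (Nat.pos_of_ne_zero hn₁) hp.one_lt
      have hp0 : 0 < w (p : F) := lt_of_le_of_lt zero_le hQp
      -- `pQ ∈ E₂` with `|z(pQ)| = |p| |z(Q)|`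
      have hpQ : p • Q ∈ kernel w V := (val_zCoord_nsmul (w := w) (V := V) p hQ).1
      have hzp : w (p • Q).zCoord = w (p : F) * w Q.zCoord := val_zCoord_nsmul_eq_of_lt p hQ hQp
      have hzp' : w (p • Q).zCoord < w (p : F) := by
        rw [hzp]; exact mul_lt_of_lt_one_right hp0 h1
      have hrec := ih n₁ hn₁lt hn₁ hpQ hzp'
      rw [show (p * n₁) • Q = n₁ • (p • Q) by rw [mul_comm, mul_smul], hrec, hzp, Nat.cast_mul,
        map_mul]
      ring
    · have hn1 : w (n : F) = 1 := hunit n hpn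
      exact val_zCoord_nsmul_eq_of_lt n hQ (by rw [hn1]; exact h1)

end Literature.NumberTheory.EllipticCurves.FormalGroupChart

/-! ## §2 Integers prime to `p`, and the value of `z` at a rational point of `E₁` -/

namespace IsDedekindDomain.HeightOneSpectrum

open Literature.NumberTheory.EllipticCurves Literature.NumberTheory.EllipticCurves.FormalGroupChart
  Literature.NumberTheory.GaloisRepresentations Field _root_.WeierstrassCurve

variable {K : Type u} [Field K] [NumberField K] {v : HeightOneSpectrum (𝓞 K)}
  {p : ℕ} [hp : Fact p.Prime] (hpv : (p : 𝓞 K) ∈ v.asIdeal)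
  {w : Valuation (AlgebraicClosure (v.adicCompletion K)) ℝ≥0}
  (hw : ∀ x, (w x : ℝ) = spectralNorm (v.adicCompletion K) (AlgebraicClosure (v.adicCompletion K)) x)

omit [NumberField K] in
include hpv in
/-- A natural number prime to `p` does not lie in a place `v ∋ p` (Bézout). [folklore] -/
theorem natCast_not_mem_asIdeal_of_prime_mem {n : ℕ} (hn : ¬ p ∣ n) : (n : 𝓞 K) ∉ v.asIdeal := by
  intro hmem
  have hcop : Nat.Coprime p n := (Nat.Prime.coprime_iff_not_dvd hp.out).mpr hn
  obtain ⟨a, b, hab⟩ := Nat.isCoprime_iff_coprime.mpr hcop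
  apply v.isPrime.ne_top
  rw [Ideal.eq_top_iff_one]
  have h1 : ((a * p + b * n : ℤ) : 𝓞 K) = 1 := by rw [hab, Int.cast_one]
  rw [← h1]
  push_cast
  exact v.asIdeal.add_mem (v.asIdeal.mul_mem_left _ hpv) (v.asIdeal.mul_mem_left _ hmem)

include hpv hw in
/-- A natural number prime to `p` has spectral valuation `1` on `K̄_v`, `v ∣ p`. [folklore] -/
theorem spectralValuation_natCast_eq_one_of_not_dvd {n : ℕ} (hn : ¬ p ∣ n) :
    w (n : AlgebraicClosure (v.adicCompletion K)) = 1 := by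
  have h := spectralValuation_intCast_eq_one hw (n := (n : ℤ))
    (by rw [Int.cast_natCast]; exact natCast_not_mem_asIdeal_of_prime_mem hpv hn)
  rwa [Int.cast_natCast] at h

include hpv hw in
/-- **`|N|_v ≤ |p|_v^m` forces `p^m ∣ N`** (`N ≠ 0`): write `N = p^j N'` with `p ∤ N'`, so
`|N| = |p|^j`. [folklore] -/
theorem pow_dvd_of_spectralValuation_natCast_le {N m : ℕ} (hN : N ≠ 0)
    (hle : w (N : AlgebraicClosure (v.adicCompletion K)) ≤
      w (p : AlgebraicClosure (v.adicCompletion K)) ^ m) : p ^ m ∣ N := by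
  obtain ⟨j, N', hN', rfl⟩ := Nat.exists_eq_pow_mul_and_not_dvd hN p hp.out.ne_one
  haveI : CharZero (AlgebraicClosure (v.adicCompletion K)) :=
    charZero_of_injective_algebraMap (algebraMap K _).injective
  have hp0 : 0 < w (p : AlgebraicClosure (v.adicCompletion K)) := by
    rw [Valuation.pos_iff]; exact Nat.cast_ne_zero.mpr hp.out.ne_zero
  have hp1 : w (p : AlgebraicClosure (v.adicCompletion K)) < 1 := by
    have h := spectralValuation_algebraMap_ringOfIntegers_lt_one (v := v) hw hpv
    rwa [map_natCast] at h
  rw [Nat.cast_mul, Nat.cast_pow, map_mul, map_pow, spectralValuation_natCast_eq_one_of_not_dvd hpv hw hN',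
    mul_one] at hle
  have hmj : m ≤ j := (pow_le_pow_iff_right_of_lt_one₀ hp0 hp1).mp hle
  exact (pow_dvd_pow p hmj).mul_right N'

omit hp in
include hw in
/-- **A `Γ_{K_v}`-invariant point of `E₁(K̄_v)` has `|z| ≤ |p|`** when `p` is a uniformizer of
`K_v` (`v ∣ p` unramified): its local parameter `z = -x/y` is `Γ_{K_v}`-invariant with `|z| < 1`,
and the value group of `K_v^{nr} ⊇ K_v` is `|p|^ℤ` (tree `spectralValuation_le_of_forall_inertia`).
Silverman, *AEC*, VII.2.2 (`E₁(K) ≅ Ê(𝓜)`). [cite: SilvermanAEC2009, Prop. VII.2.2] -/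
theorem val_zCoord_le_of_forall_smul_eq {𝔐 : Ideal (localAbsIntegers v)} (h𝔐 : 𝔐 ∈ v.localPrimesAbove)
    (hϖ : Irreducible ((p : ℕ) : v.adicCompletionIntegers K))
    {W : WeierstrassCurve K}
    [hV : (W.baseChange (AlgebraicClosure (v.adicCompletion K))).IsIntegral w.integer]
    {Q : localPoints W (v.adicCompletion K)}
    (hQ : (Q : (W.baseChange (AlgebraicClosure (v.adicCompletion K))).toAffine.Point) ∈
      kernel w (W.baseChange (AlgebraicClosure (v.adicCompletion K))))
    (hfix : ∀ σ : absoluteGaloisGroup (v.adicCompletion K), σ • Q = Q) :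
    w (Q : (W.baseChange (AlgebraicClosure (v.adicCompletion K))).toAffine.Point).zCoord ≤
      w (p : AlgebraicClosure (v.adicCompletion K)) := by
  -- the coordinates of `Q` are `Γ`-invariant
  have hz : ∀ σ : absoluteGaloisGroup (v.adicCompletion K),
      σ • (Q : (W.baseChange (AlgebraicClosure (v.adicCompletion K))).toAffine.Point).zCoord =
        (Q : (W.baseChange (AlgebraicClosure (v.adicCompletion K))).toAffine.Point).zCoord := by
    intro σ
    rcases Q with _ | ⟨x, y, h⟩
    · change σ • (0 : AlgebraicClosure (v.adicCompletion K)) = 0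
      exact smul_zero σ
    · have hσ := hfix σ
      rw [localPoints.smul_def, Affine.Point.map_some] at hσ
      injection hσ with hx hy
      change σ • (-x / y) = -x / y
      rw [smul_div₀', smul_neg]
      exact congrArg₂ (fun a b ↦ -a / b) hx hy
  have hx : ∀ σ ∈ 𝔐.inertia (absoluteGaloisGroup (v.adicCompletion K)),
      absoluteGaloisGroup.toAlgEquiv (v.adicCompletion K) σ
        (Q : (W.baseChange (AlgebraicClosure (v.adicCompletion K))).toAffine.Point).zCoord =
        (Q : (W.baseChange (AlgebraicClosure (v.adicCompletion K))).toAffine.Point).zCoord :=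
    fun σ _ ↦ hz σ
  have h1 := spectralValuation_le_of_forall_inertia hw h𝔐 hϖ hx (val_zCoord_lt_one (w := w) hQ)
  rwa [SubringClass.coe_natCast, map_natCast] at h1

/-! ## §3 The Kummer point `u₁` and input (C2) -/

include hpv hw in
/-- **The Kummer point of `E₁(K̄_v)` (input (C2) of the local skeleton).** Let `v ∣ p` with `p` a
uniformizer of `K_v`, `E/K` with `w`-integral coefficients over `K̄_v`, and suppose a fixed
`N₀ ≥ 1` multiplies every `Γ_{K_v}`-invariant point of `E(K̄_v)` into the kernel of reduction
`E₁`. Then the point `u₁ ∈ E₁(K̄_v)` with local parameter `z(u₁) = p²`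
(`exists_mem_kernel_zCoord_eq`, Hensel) is `Γ_{K_v}`-invariant, and whenever `n u₁ = p^m a` with
`a` invariant, `p^m ∣ p N₀ n`: multiply by `p N₀` to land in `E₂ = {|z| < |p|}`, where
`|z(kQ)| = |k| |z(Q)|` (`val_zCoord_nsmul_eq`), and compare `|p N₀ n| |p|² = |p|^m |z(pN₀a)| ≤ |p|^{m+2}`.
Silverman, *AEC*, VII.2.2, IV.6.4; Greenberg, LNM 1716, Lemma 3.4 (the image of
`E(K_v) ⊗ ℚ_p/ℤ_p`). [cite: SilvermanAEC2009, Prop. VII.2.2] -/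
theorem exists_kummerPoint {𝔐 : Ideal (localAbsIntegers v)} (h𝔐 : 𝔐 ∈ v.localPrimesAbove)
    (hϖ : Irreducible ((p : ℕ) : v.adicCompletionIntegers K))
    (W : WeierstrassCurve K) [W.IsElliptic]
    [hV : (W.baseChange (AlgebraicClosure (v.adicCompletion K))).IsIntegral w.integer]
    {N₀ : ℕ} (hN₀ : 0 < N₀)
    (hN₀E₁ : ∀ a : localPoints W (v.adicCompletion K),
      (∀ σ : absoluteGaloisGroup (v.adicCompletion K), σ • a = a) →
        ((N₀ • a : localPoints W (v.adicCompletion K)) :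
          (W.baseChange (AlgebraicClosure (v.adicCompletion K))).toAffine.Point) ∈
          kernel w (W.baseChange (AlgebraicClosure (v.adicCompletion K)))) :
    ∃ u₁ : localPoints W (v.adicCompletion K),
      (∀ σ : absoluteGaloisGroup (v.adicCompletion K), σ • u₁ = u₁) ∧
      (u₁ : (W.baseChange (AlgebraicClosure (v.adicCompletion K))).toAffine.Point) ∈
        kernel w (W.baseChange (AlgebraicClosure (v.adicCompletion K))) ∧
      ∀ (m : ℕ) (n : ℤ) (a : localPoints W (v.adicCompletion K)),
        (∀ σ : absoluteGaloisGroup (v.adicCompletion K), σ • a = a) → n • u₁ = p ^ m • a →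
          ((p ^ m : ℕ) : ℤ) ∣ ((p * N₀ : ℕ) : ℤ) * n := by
  haveI : CharZero (AlgebraicClosure (v.adicCompletion K)) :=
    charZero_of_injective_algebraMap (algebraMap K _).injective
  set Ω := AlgebraicClosure (v.adicCompletion K) with hΩ
  have hp0 : 0 < w (p : Ω) := by rw [Valuation.pos_iff]; exact Nat.cast_ne_zero.mpr hp.out.ne_zero
  have hp1 : w (p : Ω) < 1 := by
    have h := spectralValuation_algebraMap_ringOfIntegers_lt_one (v := v) hw hpv
    rwa [map_natCast] at h
  have hunit : ∀ n : ℕ, ¬ p ∣ n → w (n : Ω) = 1 := fun n hn ↦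
    spectralValuation_natCast_eq_one_of_not_dvd hpv hw hn
  -- the curve `(W ⊗ K_v) ⊗ K̄_v = W ⊗ K̄_v` and the transport of points
  have hbb : (W.baseChange (v.adicCompletion K)).baseChange Ω = W.baseChange Ω :=
    (W.map_baseChange (IsScalarTower.toAlgHom K (v.adicCompletion K) Ω) : _)
  haveI hV' : ((W.baseChange (v.adicCompletion K)).baseChange Ω).IsIntegral w.integer := by
    rw [hbb]; exact hV
  set T : ((W.baseChange (v.adicCompletion K)).baseChange Ω).toAffine.Point ≃+
      localPoints W (v.adicCompletion K) := Affine.Point.congrEquiv hbb with hTdef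
  -- the Hensel point with `z = p²`
  have hp2 : w ((p : Ω) ^ 2) < 1 := by rw [map_pow]; exact pow_lt_one₀ zero_le hp1 two_ne_zero
  obtain ⟨P, hPker, hPz, hPfix⟩ :=
    exists_mem_kernel_zCoord_eq (w := w) (W.baseChange (v.adicCompletion K)) hp2
  -- transport lemmas: coordinates are unchanged
  have hTsome : ∀ x y h, ∃ h', T (.some x y h) = .some x y h' := fun x y h ↦
    ⟨_, Affine.Point.congrEquiv_some hbb h⟩
  have hTz : ∀ Q : ((W.baseChange (v.adicCompletion K)).baseChange Ω).toAffine.Point,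
      ((T Q : localPoints W (v.adicCompletion K)) : (W.baseChange Ω).toAffine.Point).zCoord =
        Q.zCoord := by
    intro Q
    rcases Q with _ | ⟨x, y, h⟩
    · rw [← WeierstrassCurve.Affine.Point.zero_def, map_zero]; rfl
    · obtain ⟨h', e⟩ := hTsome x y h
      rw [e]; rfl
  have hTker : ∀ Q : ((W.baseChange (v.adicCompletion K)).baseChange Ω).toAffine.Point,
      Q ∈ kernel w ((W.baseChange (v.adicCompletion K)).baseChange Ω) →
      ((T Q : localPoints W (v.adicCompletion K)) : (W.baseChange Ω).toAffine.Point) ∈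
        kernel w (W.baseChange Ω) := by
    intro Q hQ
    rcases Q with _ | ⟨x, y, h⟩
    · rw [← WeierstrassCurve.Affine.Point.zero_def, map_zero]; exact (kernel w _).zero_mem
    · obtain ⟨h', e⟩ := hTsome x y h
      rw [e]
      exact some_mem_kernel (w := w) h' ((some_mem_kernel_iff (w := w) h).mp hQ)
  have hTsmul : ∀ (σ : absoluteGaloisGroup (v.adicCompletion K))
      (Q : ((W.baseChange (v.adicCompletion K)).baseChange Ω).toAffine.Point),
      σ • (T Q : localPoints W (v.adicCompletion K)) =
        T (Affine.Point.map (show Ω ≃ₐ[v.adicCompletion K] Ω from σ : Ω →ₐ[v.adicCompletion K] Ω) Q) := by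
    intro σ Q
    rcases Q with _ | ⟨x, y, h⟩
    · rw [← WeierstrassCurve.Affine.Point.zero_def, Affine.Point.map_zero, map_zero]
      exact smul_zero σ
    · obtain ⟨h', e⟩ := hTsome x y h
      rw [e, Affine.Point.map_some, localPoints.smul_def, Affine.Point.map_some]
      obtain ⟨h'', e'⟩ := hTsome _ _ ((WeierstrassCurve.Affine.baseChange_nonsingular
        (W := (W.baseChange (v.adicCompletion K)).toAffine)
        (show Ω ≃ₐ[v.adicCompletion K] Ω from σ : Ω →ₐ[v.adicCompletion K] Ω).injective ..).mpr h)
      rw [e']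
      rfl
  refine ⟨T P, fun σ ↦ ?_, hTker P hPker, fun m n a hfix hna ↦ ?_⟩
  · -- invariance: `σ` is a `w`-isometry fixing `p²`
    rw [hTsmul, hPfix σ (fun z ↦ spectralValuation_smul hw σ z) (by
      rw [map_pow, map_natCast])]
  · -- (C2). The point `u₁ = T P`: in `E₁`, with `|z(u₁)| = |p|² < |p|`
    have hu₁ker : ((T P : localPoints W (v.adicCompletion K)) : (W.baseChange Ω).toAffine.Point) ∈
        kernel w (W.baseChange Ω) := hTker P hPker
    have hu₁z : w ((T P : localPoints W (v.adicCompletion K)) :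
        (W.baseChange Ω).toAffine.Point).zCoord = w (p : Ω) ^ 2 := by rw [hTz, hPz, map_pow]
    have hu₁zlt : w ((T P : localPoints W (v.adicCompletion K)) :
        (W.baseChange Ω).toAffine.Point).zCoord < w (p : Ω) := by
      rw [hu₁z, sq]; exact mul_lt_of_lt_one_left hp0 hp1
    -- reduce to a natural number `n'` and an invariant `a'`
    obtain ⟨n', a', ha'fix, hn'a, hback⟩ : ∃ (n' : ℕ) (a' : localPoints W (v.adicCompletion K)),
        (∀ σ : absoluteGaloisGroup (v.adicCompletion K), σ • a' = a') ∧
        n' • (T P : localPoints W (v.adicCompletion K)) = p ^ m • a' ∧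
        (p ^ m ∣ p * N₀ * n' → ((p ^ m : ℕ) : ℤ) ∣ ((p * N₀ : ℕ) : ℤ) * n) := by
      rcases Int.natAbs_eq n with hn | hn
      · refine ⟨n.natAbs, a, hfix, ?_, fun h ↦ ?_⟩
        · rw [← natCast_zsmul, ← hn]; exact hna
        · rw [hn, ← Nat.cast_mul]; exact Int.natCast_dvd_natCast.mpr h
      · refine ⟨n.natAbs, -a, fun σ ↦ by rw [smul_neg, hfix], ?_, fun h ↦ ?_⟩
        · have e1 : ((n.natAbs : ℕ) : ℤ) = -n := by omega
          rw [← natCast_zsmul, e1, neg_smul, hna, smul_neg]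
        · rw [hn, mul_neg, dvd_neg, ← Nat.cast_mul]; exact Int.natCast_dvd_natCast.mpr h
    refine hback ?_
    rcases Nat.eq_zero_or_pos n' with rfl | hn'pos
    · rw [mul_zero]; exact dvd_zero _
    -- `Q = N₀ a'` is invariant and in `E₁`, so `|z(Q)| ≤ |p|`; `Q₂ = p Q ∈ E₂`
    have hQker : ((N₀ • a' : localPoints W (v.adicCompletion K)) : (W.baseChange Ω).toAffine.Point) ∈
        kernel w (W.baseChange Ω) := hN₀E₁ a' ha'fix
    have hQfix : ∀ σ : absoluteGaloisGroup (v.adicCompletion K), σ • (N₀ • a') = N₀ • a' :=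
      fun σ ↦ by rw [smul_comm, ha'fix σ]
    have hzQ := val_zCoord_le_of_forall_smul_eq (p := p) hw h𝔐 hϖ hQker hQfix
    obtain ⟨hQ₂ker, -, hest⟩ := val_zCoord_nsmul (w := w) (V := W.baseChange Ω) p hQker
    set Q : (W.baseChange Ω).toAffine.Point :=
      ((N₀ • a' : localPoints W (v.adicCompletion K)) : (W.baseChange Ω).toAffine.Point) with hQdef
    have hzQ₂ : w (p • Q).zCoord ≤ w (p : Ω) ^ 2 := by
      have e : (p • Q).zCoord = ((p • Q).zCoord - (p : Ω) * Q.zCoord) + (p : Ω) * Q.zCoord := by ring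
      rw [e]
      refine (Valuation.map_add w _ _).trans (max_le (hest.trans ?_) ?_)
      · rw [sq, sq]; exact mul_le_mul' hzQ hzQ
      · rw [map_mul, sq]; exact mul_le_mul' le_rfl hzQ
    have hzQ₂lt : w (p • Q).zCoord < w (p : Ω) :=
      lt_of_le_of_lt hzQ₂ (by rw [sq]; exact mul_lt_of_lt_one_left hp0 hp1)
    -- the identity `(p N₀ n') u₁ = p^m (p N₀ a')`
    have hid : (p * N₀ * n') • ((T P : localPoints W (v.adicCompletion K)) :
        (W.baseChange Ω).toAffine.Point) = p ^ m • (p • Q) := by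
      change (p * N₀ * n') • (T P : localPoints W (v.adicCompletion K)) =
        p ^ m • p • N₀ • a'
      rw [mul_smul, hn'a, smul_comm (p * N₀) (p ^ m) a', mul_smul]
    -- valuations of both sides
    have hpN : p * N₀ * n' ≠ 0 := Nat.mul_ne_zero (Nat.mul_ne_zero hp.out.ne_zero hN₀.ne') hn'pos.ne'
    have lhs := val_zCoord_nsmul_eq (w := w) (V := W.baseChange Ω) hp.out hunit (p * N₀ * n') hpN
      hu₁ker hu₁zlt
    have rhs := val_zCoord_nsmul_eq (w := w) (V := W.baseChange Ω) hp.out hunit (p ^ m)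
      (pow_ne_zero m hp.out.ne_zero) hQ₂ker hzQ₂lt
    have key : w (p ^ m • (p • Q)).zCoord = w ((p * N₀ * n' : ℕ) : Ω) * w (p : Ω) ^ 2 := by
      rw [← hu₁z, ← lhs]
      exact congrArg (fun R : (W.baseChange Ω).toAffine.Point ↦ w R.zCoord) hid.symm
    rw [rhs, Nat.cast_pow, map_pow] at key
    -- `|p|^m |z(Q₂)| = |pN₀n'| |p|²` with `|z(Q₂)| ≤ |p|²`
    have hle : w ((p * N₀ * n' : ℕ) : Ω) * w (p : Ω) ^ 2 ≤ w (p : Ω) ^ m * w (p : Ω) ^ 2 := by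
      rw [← key]; exact mul_le_mul' le_rfl hzQ₂
    have hp2pos : 0 < w (p : Ω) ^ 2 := pow_pos hp0 2
    exact pow_dvd_of_spectralValuation_natCast_le hpv hw hpN (le_of_mul_le_mul_right hle hp2pos)

end IsDedekindDomain.HeightOneSpectrum
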